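import Literature.AlgebraicGeometry.Frobenioids.PadicAlgClRationalOrd
import Literature.AnabelianGeometry.SemiGraphs.CosetCategories
import Literature.AnabelianGeometry.SemiGraphs.TemperedAnabelian
import Literature.IUT.LogVolume.RamificationInvariants
import Literature.NumberTheory.GaloisRepresentations.ArtinRestriction
import Mathlib.NumberTheory.Padics.ProperSpace
import HarnessLib

/-!
# [EtTh] Def. 3.3 (iii) / Prop. 3.4 (ii) for the BASE-FIELD-THEORETIC HULL over the genuine base `B^temp(Π)⁰` (small model
# `CosetCat Π`), part 1: the base fields `K_U`, their value groups `(1/e_U)·ℤ`, and the constants `B₀(U) = Hom_Π(Π/U, ℚ̄_p^×) ≅ K_U^×`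

S. Mochizuki, *The étale theta function …*, Publ. RIMS **45** (2009) [MochizukiEtTh2009]: Def. 3.3 (iii) p.299 (PDF p.73)
(«`B₀(Y^log)` … `F₀ ⊆ B₀` the subfunctor determined by the constant log-meromorphic functions»), Prop. 3.4 (ii) p.300 (PDF p.74)
(«`O_L^× ≅ Ker(B₀ → Φ₀^gp)`, `L^× ≅ F₀(Y^log)` for `Y` geometrically connected over the finite extension `L` of `K`»), Def. 3.6 (iv)
p.304 (PDF p.78) («the base-field-theoretic hull `C^{bs-fld}` … a `p`-adic Frobenioid»), §5 p.322 (PDF p.96) («geometrically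
connected over `K`»); S. Mochizuki, *The geometry of Frobenioids II* (2008) [MochizukiFrdII2008], Ex. 1.1 (i) p.7 (`ord(O_K^▷)`,
the value group of a `p`-adic field), Ex. 1.3 (ii)–(iii) pp.11–12 (the `p`-adic Frobenioid over `B^temp(G)⁰`: «`Π/Π°` ↦ the field
`K̄^{Π°}`»).  [cite: MochizukiEtTh2009, Def 3.3 (iii) p.299 (PDF p.73); Prop 3.4 (ii) p.300 (PDF p.74)]

abc-iut cell, layer L2, seat abc-iut-L2-d3 (gen 10); L2-lead ruling R1112 «CONST-DICT CARRIER = C^{bs-fld} HULL OVER THE GENUINE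
BASE» (reading (i): a tempered Frobenioid over the GENUINE base `B^temp(Π^tp_X̲̲)⁰` with genuine `ℚ̄_p` constants and genuine Galois
action counts as a carrier of record for the constants dictionary; degenerate divisor geometry DISPLAYED).  CLASS (b) CONSTRUCTION,
part 1 of 2 (part 2: `DivisorMonoidsOfBaseFieldHull.lean` assembles the `DivisorMonoids` datum), for ANY topological group `Γ`
(print's `Π`; `Π` is a reserved token) with a homomorphism `a : Γ → G_{ℚ_p} = Gal(ℚ̄_p/ℚ_p)` whose open subgroups have OPEN images
`ha` (at `Π^tp_X̲̲`: the augmentation, by the open mapping theorem for tempered groups, abc-iut-w5-d111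
`TemperedCurve.isOpenMap_augGK_of_isTempered`; here `isOpen_map_of_isOpenMap`), over abc-iut-L5-t2's SMALL model `CosetCat Γ` of
`B^temp(Γ)⁰` (objects the open subgroups `U`, standing for `Γ/U`):
* §1 `ramIdx E`, `exists_ordFun_coe_eq`, `exists_unit_ordFun_eq` — for a finite `E ⊆ ℚ̄_p`: **`ord(E^×) = (1/e)·ℤ`** with `e` the
  absolute ramification index (abc-iut-S1's `absRamificationIdx` / `exists_norm_eq_rpow(_neg)`, read through the rational order
  `RationalOrd.ordFun` of `PadicAlgClRationalOrd.lean`);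
* §2 `fixFld a U = ℚ̄_p^{a(U)}` — the base field `K_U` of `Γ/U`, FINITE over `ℚ_p` (Krull's correspondence, the tree's
  `finiteDimensional_fixedField_of_isOpen`); `idx a ha U = e_U` its ramification index with the two value-group clauses
  (`exists_ordFun_eq_of_mem_fixFld`, `exists_mem_fixFld_ordFun_eq`);
* §3 **`eqvFun a U = B₀(U) := Hom_Γ(Γ/U, ℚ̄_p^×)`**, the `Γ`-equivariant maps `b(g·x) = a(g)·b(x)`: evaluation at the base point `ev`
  is injective with image EXACTLY the nonzero elements of `K_U` (`ev_mem_fixFld`, `range_ev`, inverse `ofFixed`: print's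
  «`L^× ≅ F₀(Y^log)`»); pull-back `pullFun f = (· ∘ f)` along a covering map `f : Γ/V → Γ/U` is, at the base point, the GALOIS
  TRANSLATE `a(g)·ev b` (`ev_pullFun`), so **`ord` is pull-back invariant** (`ordFun_ev_pullFun`, by `RationalOrd.ordFun_algEquiv`)
  and pull-backs are injective.
HONEST LABEL: genuine constants (`ℚ̄_p`, genuine Galois action through `a`), classical valuation theory; no curve, no rational
functions, no cusps.  No instance, no notation, no `Prop`-valued definition, no sorry; nothing here bears on [IUTchIII] Cor. 3.12;
no side taken; typed ≠ proved elsewhere.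
-/

noncomputable section

namespace Literature.AnabelianGeometry.EtaleTheta

open CategoryTheory Opposite Multiplicative Literature.AlgebraicGeometry.Frobenioids Literature.AnabelianGeometry.SemiGraphs
  Literature.AlgebraicGeometry.Frobenioids.RationalOrd

namespace BsFldHull

variable (p : ℕ) [Fact p.Prime]

/-! ## §1 The value group of a finite `E ⊆ ℚ̄_p` read through `ord`: `ord(E^×) = (1/e)·ℤ` -/

section ValueGroup

variable (E : IntermediateField ℚ_[p] (PadicAlgCl p)) [FiniteDimensional ℚ_[p] E]

/-- The absolute ramification index `e = e(E/ℚ_p)` of a finite `E ⊆ ℚ̄_p` (abc-iut-S1's `absRamificationIdx` at the proper normed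
field `E`). [cite: MochizukiFrdII2008, Ex 1.1 (i) p.7] -/
def ramIdx : ℕ :=
  haveI : ProperSpace E := FiniteDimensional.proper ℚ_[p] E
  Literature.IUT.LogVolume.absRamificationIdx p E

/-- `e ≥ 1`. [cite: MochizukiFrdII2008, Ex 1.1 (i) p.7] -/
theorem ramIdx_pos : 0 < ramIdx p E := by
  haveI : ProperSpace E := FiniteDimensional.proper ℚ_[p] E
  exact Literature.IUT.LogVolume.absRamificationIdx_pos p E

/-- `(e : ℚ) ≠ 0`. [cite: MochizukiFrdII2008, Ex 1.1 (i) p.7] -/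
theorem ramIdx_cast_ne_zero : (ramIdx p E : ℚ) ≠ 0 := by exact_mod_cast (ramIdx_pos p E).ne'

/-- **`ord(E^×) ⊆ (1/e)·ℤ`**: the order of a nonzero element of `E` is `m/e` for an integer `m` (the value group of the discretely
valued `E` is `p^{(1/e)ℤ}`, abc-iut-S1's `exists_norm_eq_rpow`). [cite: MochizukiFrdII2008, Ex 1.1 (i) p.7] -/
theorem exists_ordFun_coe_eq (x : E) (hx : x ≠ 0) : ∃ m : ℤ, ordFun p (x : PadicAlgCl p) = m / ramIdx p E := by
  haveI : ProperSpace E := FiniteDimensional.proper ℚ_[p] E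
  obtain ⟨m, hm⟩ := Literature.IUT.LogVolume.exists_norm_eq_rpow p E hx
  refine ⟨m, (ordFun_eq_iff p (by exact_mod_cast hx) _).mpr ?_⟩
  change ‖x‖ = _ at hm
  rw [show ‖(x : PadicAlgCl p)‖ = ‖x‖ from rfl, hm]
  congr 1
  push_cast
  unfold ramIdx
  ring

/-- **`(1/e)·ℤ ⊆ ord(E^×)`**: every `m/e` is the order of a unit of `E` (a power of a uniformiser; abc-iut-S1's
`exists_norm_eq_rpow_neg`). [cite: MochizukiFrdII2008, Ex 1.1 (i) p.7] -/
theorem exists_unit_ordFun_eq (m : ℤ) : ∃ g : (E)ˣ, ordFun p ((g : E) : PadicAlgCl p) = m / ramIdx p E := by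
  haveI : ProperSpace E := FiniteDimensional.proper ℚ_[p] E
  obtain ⟨g, hg⟩ := Literature.IUT.LogVolume.exists_norm_eq_rpow_neg p E m
  refine ⟨g, (ordFun_eq_iff p (by exact_mod_cast g.ne_zero) _).mpr ?_⟩
  rw [show ‖((g : E) : PadicAlgCl p)‖ = ‖(g : E)‖ from rfl, hg]
  congr 1
  push_cast
  unfold ramIdx
  ring

end ValueGroup

/-! ## §2 The base fields `K_U = ℚ̄_p^{a(U)}` of the coverings `Π/U` -/

variable {Γ : Type} [Group Γ] [TopologicalSpace Γ] (a : Γ →* GQp p)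

/-- **`K_U := ℚ̄_p^{a(U)}`**, the base field of the connected covering `Π/U` ([FrdII] Ex. 1.3 (iii): «the field `K̄^{Π°}`»; [EtTh]
Prop. 3.4 (ii): the finite extension `L` of `K` over which `Y` is geometrically connected). [cite: MochizukiFrdII2008, Ex 1.3 (iii) p.12] -/
def fixFld (U : OpenSubgroup Γ) : IntermediateField ℚ_[p] (PadicAlgCl p) :=
  IntermediateField.fixedField (U.toSubgroup.map a)

/-- Membership in `K_U`: fixed by `a(u)` for all `u ∈ U`. [cite: MochizukiFrdII2008, Ex 1.3 (iii) p.12] -/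
theorem mem_fixFld_iff (U : OpenSubgroup Γ) (x : PadicAlgCl p) : x ∈ fixFld p a U ↔ ∀ u ∈ U, a u x = x := by
  constructor
  · intro hx u hu
    exact hx ⟨a u, Subgroup.mem_map_of_mem a hu⟩
  · rintro hx ⟨σ, hσ⟩
    obtain ⟨u, hu, rfl⟩ := Subgroup.mem_map.mp hσ
    exact hx u hu

variable (ha : ∀ U : OpenSubgroup Γ, IsOpen ((U.toSubgroup.map a : Subgroup (GQp p)) : Set (GQp p)))

include ha in
/-- **`K_U` is finite over `ℚ_p`** when `a(U)` is open (Krull's Galois correspondence; the tree's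
`finiteDimensional_fixedField_of_isOpen`). [cite: MochizukiFrdII2008, Ex 1.3 (iii) p.12] -/
theorem finiteDimensional_fixFld (U : OpenSubgroup Γ) : FiniteDimensional ℚ_[p] (fixFld p a U) :=
  Literature.NumberTheory.GaloisRepresentations.finiteDimensional_fixedField_of_isOpen (F := ℚ_[p]) _ (ha U)

/-- An open map `a` carries open subgroups to open subgroups (the form of the hypothesis supplied at `Π^tp_X` by the open mapping
theorem for tempered groups). [cite: MochizukiSemiAnbd2006, Ex 3.10 p.43] -/
theorem isOpen_map_of_isOpenMap (hopen : IsOpenMap a) (U : OpenSubgroup Γ) :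
    IsOpen ((U.toSubgroup.map a : Subgroup (GQp p)) : Set (GQp p)) :=
  hopen _ U.isOpen

include ha in
/-- **The value group of `K_U` is `(1/e)·ℤ` for a (unique) `e ≥ 1`** — its absolute ramification index (`ramIdx`); packaged as ONE
existential so that the index below unfolds to nothing heavier than a choice. [cite: MochizukiFrdII2008, Ex 1.1 (i) p.7] -/
theorem exists_idx (U : OpenSubgroup Γ) : ∃ e : ℕ, 0 < e ∧
    (∀ x : PadicAlgCl p, x ∈ fixFld p a U → x ≠ 0 → ∃ m : ℤ, ordFun p x = m / e) ∧
    (∀ m : ℤ, ∃ x : PadicAlgCl p, x ∈ fixFld p a U ∧ x ≠ 0 ∧ ordFun p x = m / e) := by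
  haveI := finiteDimensional_fixFld p a ha U
  refine ⟨ramIdx p (fixFld p a U), ramIdx_pos p _, fun x hx hx0 => ?_, fun m => ?_⟩
  · exact exists_ordFun_coe_eq p (fixFld p a U) ⟨x, hx⟩ (fun h => hx0 (congrArg Subtype.val h))
  · obtain ⟨g, hg⟩ := exists_unit_ordFun_eq p (fixFld p a U) m
    exact ⟨(g : fixFld p a U), (g : fixFld p a U).2, by exact_mod_cast g.ne_zero, hg⟩

/-- **The ramification index `e_U` of `K_U/ℚ_p`** (the `e` of `exists_idx`; equal to `ramIdx (fixFld a U)`).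
[cite: MochizukiFrdII2008, Ex 1.1 (i) p.7] -/
def idx (U : OpenSubgroup Γ) : ℕ := Classical.choose (exists_idx p a ha U)

/-- `e_U ≥ 1`. [cite: MochizukiFrdII2008, Ex 1.1 (i) p.7] -/
theorem idx_pos (U : OpenSubgroup Γ) : 0 < idx p a ha U := (Classical.choose_spec (exists_idx p a ha U)).1

/-- `(e_U : ℚ) ≠ 0`. [cite: MochizukiFrdII2008, Ex 1.1 (i) p.7] -/
theorem idx_cast_ne_zero (U : OpenSubgroup Γ) : (idx p a ha U : ℚ) ≠ 0 := by exact_mod_cast (idx_pos p a ha U).ne'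

/-- `ord(K_U^×) ⊆ (1/e_U)·ℤ`. [cite: MochizukiFrdII2008, Ex 1.1 (i) p.7] -/
theorem exists_ordFun_eq_of_mem_fixFld (U : OpenSubgroup Γ) {x : PadicAlgCl p} (hx : x ∈ fixFld p a U) (hx0 : x ≠ 0) :
    ∃ m : ℤ, ordFun p x = m / idx p a ha U :=
  (Classical.choose_spec (exists_idx p a ha U)).2.1 x hx hx0

/-- `(1/e_U)·ℤ ⊆ ord(K_U^×)`: an element of `K_U` of order `m/e_U`. [cite: MochizukiFrdII2008, Ex 1.1 (i) p.7] -/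
theorem exists_mem_fixFld_ordFun_eq (U : OpenSubgroup Γ) (m : ℤ) :
    ∃ x : PadicAlgCl p, x ∈ fixFld p a U ∧ x ≠ 0 ∧ ordFun p x = m / idx p a ha U :=
  (Classical.choose_spec (exists_idx p a ha U)).2.2 m

/-! ## §3 `B₀(U) = Hom_Γ(Γ/U, ℚ̄_p^×) ≅ K_U^×` — the constants, with their genuine Galois action -/

/-- **`B₀(U) := Hom_Γ(Γ/U, ℚ̄_p^×)`**: the `Γ`-equivariant maps `b : Γ/U → ℚ̄_p^×`, `b(g·x) = a(g)·b(x)` — the constant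
log-meromorphic functions of the covering `Γ/U`, i.e. (by evaluation at `1·U`) the multiplicative group `K_U^×` of its base field,
recorded choice-free («`L^× ≅ F₀(Y^log)`», Prop. 3.4 (ii)). [cite: MochizukiEtTh2009, Def 3.3 (iii) p.299 (PDF p.73)] -/
def eqvFun (U : CosetCat Γ) : Subgroup (U.carrier → (PadicAlgCl p)ˣ) where
  carrier := {b | ∀ (g : Γ) (x : U.carrier), b (g • x) = a g • b x}
  one_mem' g x := by simp
  mul_mem' {b c} hb hc g x := by
    change b (g • x) * c (g • x) = a g • (b x * c x)
    rw [hb, hc, smul_mul']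
  inv_mem' {b} hb g x := by
    change (b (g • x))⁻¹ = a g • (b x)⁻¹
    rw [hb, smul_inv']

/-- The equivariance law of an element of `B₀(U)`. [cite: MochizukiEtTh2009, Def 3.3 (iii) p.299 (PDF p.73)] -/
theorem eqvFun.apply_smul {U : CosetCat Γ} (b : eqvFun p a U) (g : Γ) (x : U.carrier) :
    (b : U.carrier → (PadicAlgCl p)ˣ) (g • x) = a g • (b : U.carrier → (PadicAlgCl p)ˣ) x :=
  b.2 g x

/-- **Evaluation at the base point `1·U`**, `B₀(U) → ℚ̄_p^×` (the reading of the constants in `ℚ̄_p`).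
[cite: MochizukiEtTh2009, Prop 3.4 (ii) p.300 (PDF p.74)] -/
def ev (U : CosetCat Γ) : eqvFun p a U →* (PadicAlgCl p)ˣ where
  toFun b := (b : U.carrier → (PadicAlgCl p)ˣ) ((1 : Γ) : U.carrier)
  map_one' := rfl
  map_mul' _ _ := rfl

/-- `ev` is the value at `1·U`. [cite: MochizukiEtTh2009, Prop 3.4 (ii) p.300 (PDF p.74)] -/
theorem ev_apply (U : CosetCat Γ) (b : eqvFun p a U) : ev p a U b = (b : U.carrier → (PadicAlgCl p)ˣ) ((1 : Γ) : U.carrier) := rfl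

/-- The value at `g·U` is `a(g)·ev b`. [cite: MochizukiEtTh2009, Def 3.3 (iii) p.299 (PDF p.73)] -/
theorem apply_coe (U : CosetCat Γ) (b : eqvFun p a U) (g : Γ) :
    (b : U.carrier → (PadicAlgCl p)ˣ) (g : U.carrier) = a g • ev p a U b := by
  rw [ev_apply, ← eqvFun.apply_smul, MulAction.Quotient.smul_coe, smul_eq_mul, mul_one]

/-- **The value at the base point lies in `K_U`** (`U` fixes `1·U`). [cite: MochizukiEtTh2009, Prop 3.4 (ii) p.300 (PDF p.74)] -/
theorem ev_mem_fixFld (U : CosetCat Γ) (b : eqvFun p a U) : ((ev p a U b : (PadicAlgCl p)ˣ) : PadicAlgCl p) ∈ fixFld p a U.sg := by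
  rw [mem_fixFld_iff]
  intro u hu
  have h := apply_coe p a U b u
  have hu' : ((u : Γ) : U.carrier) = ((1 : Γ) : U.carrier) := by
    rw [QuotientGroup.eq, mul_one, inv_mem_iff]
    exact hu
  rw [hu', ← ev_apply] at h
  exact (congrArg (fun v : (PadicAlgCl p)ˣ => (v : PadicAlgCl p)) h).symm

/-- **`ev` is injective** (an equivariant map on ONE orbit is determined by one value). [cite: MochizukiEtTh2009, Prop 3.4 (ii) p.300 (PDF p.74)] -/
theorem ev_injective (U : CosetCat Γ) : Function.Injective (ev p a U) := by
  intro b c h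
  apply Subtype.ext
  funext x
  induction x using QuotientGroup.induction_on with
  | H g => rw [apply_coe, apply_coe, h]

/-- **The constant function with value `x ∈ K_U^×`**: `g·U ↦ a(g)·x` (well defined since `U` fixes `x`) — the inverse reading
`K_U^× → B₀(U)`. [cite: MochizukiEtTh2009, Prop 3.4 (ii) p.300 (PDF p.74)] -/
def ofFixed (U : CosetCat Γ) (x : (PadicAlgCl p)ˣ) (hx : (x : PadicAlgCl p) ∈ fixFld p a U.sg) : eqvFun p a U :=
  ⟨fun c => Quotient.liftOn' c (fun g => a g • x) fun g h hgh => by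
      have hmem : g⁻¹ * h ∈ U.sg := QuotientGroup.leftRel_apply.mp hgh
      have hfix : a (g⁻¹ * h) • x = x := by
        apply Units.ext
        exact (mem_fixFld_iff p a U.sg x).mp hx _ hmem
      change a g • x = a h • x
      conv_lhs => rw [← hfix, ← mul_smul, ← map_mul, mul_inv_cancel_left],
    fun g c => QuotientGroup.induction_on c fun h => by
      change a (g • h : Γ) • x = a g • a h • x
      rw [smul_eq_mul, map_mul, mul_smul]⟩

/-- `ofFixed x` takes the value `a(g)·x` at `g·U`. [cite: MochizukiEtTh2009, Prop 3.4 (ii) p.300 (PDF p.74)] -/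
@[simp] theorem ofFixed_apply_coe (U : CosetCat Γ) (x : (PadicAlgCl p)ˣ) (hx : (x : PadicAlgCl p) ∈ fixFld p a U.sg) (g : Γ) :
    (ofFixed p a U x hx : U.carrier → (PadicAlgCl p)ˣ) (g : U.carrier) = a g • x := rfl

/-- `ev (ofFixed x) = x`. [cite: MochizukiEtTh2009, Prop 3.4 (ii) p.300 (PDF p.74)] -/
@[simp] theorem ev_ofFixed (U : CosetCat Γ) (x : (PadicAlgCl p)ˣ) (hx : (x : PadicAlgCl p) ∈ fixFld p a U.sg) :
    ev p a U (ofFixed p a U x hx) = x := by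
  rw [ev_apply, ofFixed_apply_coe, map_one, one_smul]

/-- **`B₀(U) ≅ K_U^×` on the nose**: `ev` is a bijection onto the units of `ℚ̄_p` lying in `K_U`.
[cite: MochizukiEtTh2009, Prop 3.4 (ii) p.300 (PDF p.74)] -/
theorem range_ev (U : CosetCat Γ) :
    Set.range (fun b : eqvFun p a U => ((ev p a U b : (PadicAlgCl p)ˣ) : PadicAlgCl p)) =
      {x : PadicAlgCl p | x ∈ fixFld p a U.sg ∧ x ≠ 0} := by
  ext x
  constructor
  · rintro ⟨b, rfl⟩
    exact ⟨ev_mem_fixFld p a U b, (ev p a U b).ne_zero⟩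
  · rintro ⟨hx, hx0⟩
    refine ⟨ofFixed p a U (Units.mk0 x hx0) hx, ?_⟩
    change ((ev p a U (ofFixed p a U (Units.mk0 x hx0) hx) : (PadicAlgCl p)ˣ) : PadicAlgCl p) = x
    rw [ev_ofFixed, Units.val_mk0]

/-- **Pull-back `B₀(U) → B₀(V)` along a covering map `f : Γ/V → Γ/U` is precomposition** (`b ↦ b ∘ f`).
[cite: MochizukiEtTh2009, Def 3.3 (iii) p.299 (PDF p.73)] -/
def pullFun {V U : CosetCat Γ} (f : V ⟶ U) : eqvFun p a U →* eqvFun p a V where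
  toFun b := ⟨fun x => (b : U.carrier → (PadicAlgCl p)ˣ) (CosetCat.Hom.toFun f x), fun g x => by
    change (b : U.carrier → (PadicAlgCl p)ˣ) (CosetCat.Hom.toFun f (g • x)) = _
    rw [CosetCat.Hom.map_smul, eqvFun.apply_smul]⟩
  map_one' := rfl
  map_mul' _ _ := rfl

/-- Values of the pull-back. [cite: MochizukiEtTh2009, Def 3.3 (iii) p.299 (PDF p.73)] -/
@[simp] theorem pullFun_apply {V U : CosetCat Γ} (f : V ⟶ U) (b : eqvFun p a U) (x : V.carrier) :
    (pullFun p a f b : V.carrier → (PadicAlgCl p)ˣ) x = (b : U.carrier → (PadicAlgCl p)ˣ) (CosetCat.Hom.toFun f x) := rfl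

/-- **The pulled-back constant, read at the base point, is a GALOIS TRANSLATE**: `ev (b ∘ f) = a(g)·ev b` for any `g` with
`f(1·V) = g·U`. [cite: MochizukiEtTh2009, Def 3.3 (iii) p.299 (PDF p.73)] -/
theorem ev_pullFun {V U : CosetCat Γ} (f : V ⟶ U) (b : eqvFun p a U) {g : Γ} (hg : CosetCat.pt f = (g : U.carrier)) :
    ev p a V (pullFun p a f b) = a g • ev p a U b := by
  rw [ev_apply, pullFun_apply, ← CosetCat.pt, hg, apply_coe]

/-- Hence **`ord` of a constant is unchanged by pull-back** (Galois invariance of `ord`). [cite: MochizukiEtTh2009, Def 3.3 (iii) p.299 (PDF p.73)] -/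
theorem ordFun_ev_pullFun {V U : CosetCat Γ} (f : V ⟶ U) (b : eqvFun p a U) :
    ordFun p ((ev p a V (pullFun p a f b) : (PadicAlgCl p)ˣ) : PadicAlgCl p) = ordFun p ((ev p a U b : (PadicAlgCl p)ˣ) : PadicAlgCl p) := by
  obtain ⟨g, hg⟩ := Quotient.exists_rep (CosetCat.pt f)
  rw [ev_pullFun p a f b hg.symm]
  exact ordFun_algEquiv p (a g) _

/-- The pull-back maps of `B₀` are injective (covering maps are onto). [cite: MochizukiEtTh2009, Def 3.3 (iii) p.299 (PDF p.73)] -/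
theorem pullFun_injective {V U : CosetCat Γ} (f : V ⟶ U) : Function.Injective (pullFun p a f) := by
  intro b c h
  obtain ⟨g, hg⟩ := Quotient.exists_rep (CosetCat.pt f)
  have h1 := congrArg (ev p a V) h
  rw [ev_pullFun p a f b hg.symm, ev_pullFun p a f c hg.symm] at h1
  exact ev_injective p a U (smul_left_cancel _ h1)

end BsFldHull

end Literature.AnabelianGeometry.EtaleTheta

end
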